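import Summits.AtomisticToContinuum.Crystallization.Theses.GappedShellCensus
import Literature.Geometry.DiscreteGeometry.AntiprismAngleBudget
import Summits.AtomisticToContinuum.Crystallization.Theorems.GappedShellCensusShellTrichotomyStubTCornerMax
import Summits.AtomisticToContinuum.Crystallization.Theorems.GappedShellCensusShellTrichotomyStubTCornerMin

/-!
# Crux `GappedShellCensus.ShellTrichotomy` (stmt-AtomisticToContinuum-18070), line `Sketch` —
# stub `stub_noAntiprism`

**The labelled hexagonal antiprism has no `2 %`-tolerant realization.**  Twelve points of `ℝ³`
with norms in `[0.98, 1.02]`, pairwise distances `≥ 0.98`, each pair either a bond (`≤ 1.02`) or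
far (`≥ 1.26`), and bond graph the hexagonal antiprism (ring `A = 0…5`, ring `B = 6…11`, label
`6 + i` bonded to `i`, `i + 1`) do not exist (`stub_noAntiprism`).  This is the one exotic
survivor of the census of four-regular twelve-vertex maps; the obstruction is global (the ring
plus four of the six band points is realizable) and dimension-sensitive (the Gram relaxation is
feasible), so the proof is an AREA BUDGET on the sphere of directions, carried out entirely in
the language of angles.

## The argument

The spherical geometry lives in `Literature/Geometry/DiscreteGeometry/AntiprismAngleBudget.lean`
(namespace `…AntiprismShell`, Parts 1–5 below); this file decodes the bond graph, normalises
the points, imports the coupled corner bounds and fixes the handedness (Part 6).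

Normalise the points to unit vectors `u k`; bonds have `⟪u, u'⟫ ∈ [c₁, c₀] = [2201/4802,
2801/5202]` (angular length `57.42°…62.72°`), far pairs `⟪u, u'⟫ ≤ 1233/5202` (Part 3).

1. **Around a vertex** (Parts 1–2).  At a shell vertex `v` the four bonded directions
   `a, w, w', b` (bond path `a w w' b`, `a b` far) make three corners `T₁, T₂, T₃` of band
   triangles, each in `[Tm, TM] = [arccos (81/200), arccos (1/4)]` by the landed coupled bounds
   `stub_tCornerMin`, `stub_tCornerMax`.  The turn from `x` to `y` about `v` is encoded by the
   complex number `pdot + i det` (`pdot = ⟪x, y⟫ − ⟪v, x⟫⟪v, y⟫`, `det = orient3 v x y`): these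
   multiply like `conj ζ_x ζ_y` (`turnZ_mul`, a polynomial identity), so around any closed chain
   of directions the arguments — `±` the unsigned angles `∠(perpTo v x, perpTo v y)` — add up
   to a multiple of `2π` (`turnZ_cycle4/6`).  With the far pair (`∠(p b, p a) > 1.53 >
   2 TM − Tm`, `closing_angle_gt`) this bookkeeping forces all turns at `v` to have ONE
   orientation and the hexagon corner `C = ∠(p b, p a) = 2π − T₁ − T₂ − T₃` (`vertex4`);
   at an odd ring vertex the two further vertices of the inscribed triangle `X₁X₃X₅` of the
   hexagon give six directions and `T₁ + T₂ + T₃ + β + ι + β' = 2π` (`vertex6`).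
2. **The ring** (Part 5).  Summing over the six vertices of a ring,
   `Σ (18 corners) = 9π − (E₀' + E₂' + E₄' + ι₁ + ι₃ + ι₅)` with `E_k'` the excesses of the
   three ears `(X_k; X_{k−1}, X_{k+1})` and `ι_j` the angles of the inscribed triangle.  The ear
   excess is at least that of the isosceles ear with legs `c₀` and the same apex angle (Euler's
   formula `1 − cos E = F`, `ear_excess`); the apex cosine `cos C = cos (T₁+T₂+T₃)` lies in
   `[−w_hi, −11/16]` (`cos 3TM = −11/16`); the inscribed triangle has sides of cosine
   `≤ c₀² − (1 − c₀²)(−cos C)` and its angles are bounded by the spherical law of cosines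
   (`inner_angle_bound`).  Splitting each apex cosine at `−21/25` (eight boxes) and certifying
   the `cos`/`arccos` constants by the polynomial brackets of `KissingAngleBounds`
   (Part 4): `E' + ι`-total `≥ B = 3371/500` per ring (`ring_budget`; the mirrored pattern of
   ring `B` is `ring_budget'`).
3. **The band** (`band_excess`).  A bonded triangle has excess `≥ 249/500` (Euler's formula and
   the corner principle `le_eulerF_of_corners₃`: the smallest triangle has the smallest area).
4. **Budget** (`no_config`, Part 6).  The `36` corners are the corners of the `12` band
   triangles: `12π + 12 · 0.498 ≤ Σ = 18π − 2B`, i.e. `19.46 ≤ 6π` — false.  The common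
   orientation is fixed to be positive by passing to the mirror image `−u` if necessary.

No new definitions (local notations only); no named facts; axioms `propext`, `Classical.choice`,
`Quot.sound`.
-/

noncomputable section

namespace Summit.AtomisticToContinuum.Crystallization.Theorems

open scoped RealInnerProductSpace
open Literature.Geometry.DiscreteGeometry Literature.Geometry.DiscreteGeometry.AntiprismShell
  InnerProductGeometry Real

local notation "E3" => EuclideanSpace ℝ (Fin 3)

/-- The normalised direction of a point. -/
local notation "nrm(" p ")" => ((‖p‖⁻¹ : ℝ) • p)

/-! ### Part 6. The stub: decoding the bond graph and fixing the handedness -/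

/-- The bond list of the labelled hexagonal antiprism (as in the statement). -/
local notation "apList" =>
  ([(0, 1), (1, 2), (2, 3), (3, 4), (4, 5), (0, 5), (6, 7), (7, 8), (8, 9), (9, 10), (10, 11), (6, 11),
    (0, 6), (1, 7), (2, 8), (3, 9), (4, 10), (5, 11), (1, 6), (2, 7), (3, 8), (4, 9), (5, 10), (0, 11)] :
    List (ℕ × ℕ))

/-- **No tolerant realization of the labelled hexagonal antiprism** (`τ = 0.02`).  Twelve
points of `ℝ³` with norms in `[0.98, 1.02]`, pairwise distances `≥ 0.98` and each either
`≤ 1.02` (a bond) or `≥ 1.26`, whose bond graph is the hexagonal antiprism — ring `A = 0…5`,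
ring `B = 6…11`, label `6 + i` bonded to `i` and `i + 1` — do not exist.

Proof (area budget on the sphere of directions, in the language of angles).  Normalise the points
to unit vectors.  At every vertex the four bonded directions make three corners
`T ∈ [arccos (81/200), arccos (1/4)]` of band triangles (`stub_tCornerMin/Max`); the signed
planar angles around the vertex add up to a multiple of `2π` (`turnZ_cycle4`, complex numbers
`pdot + i det`), which with the far pair across the vertex forces a common orientation of all
band triangles and the hexagon corner `C = 2π − T₁ − T₂ − T₃` (`vertex4`); at the odd ring
vertices six directions (the two further ring vertices of the inscribed triangle of the
hexagon) give `T₁ + T₂ + T₃ + β + ι + β' = 2π` (`vertex6`).  Summing over the `36` corners: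
`Σ (corner sums of the 12 band triangles) = 18π − Σ_rings (3 ear excesses + 3 inner angles)`.
The band triangles have excess `≥ 0.498` each (Euler's formula, `band_excess`); each ring has
`3 ear excesses + 3 inner angles ≥ 6.742` (`ring_budget`: isosceles-ear bound `ear_excess`,
spherical law of cosines for the inner triangle `inner_angle_bound`, two boxes per apex
cosine, certified `cos`/`arccos` brackets).  Hence `12π + 12 · 0.498 ≤ 18π − 2 · 6.742`,
i.e. `19.46 ≤ 6π`, a contradiction. -/
theorem stub_noAntiprism (t : Fin 12 → EuclideanSpace ℝ (Fin 3))
    (hn : ∀ k, 1 - 1 / 50 ≤ ‖t k‖ ∧ ‖t k‖ ≤ 1 + 1 / 50)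
    (hd : ∀ k l, k ≠ l → 1 - 1 / 50 ≤ dist (t k) (t l) ∧ (dist (t k) (t l) ≤ 1 + 1 / 50 ∨ 63 / 50 ≤ dist (t k) (t l)))
    (hG : ∀ k l, k ≠ l → (dist (t k) (t l) ≤ 1 + 1 / 50 ↔ (min k.val l.val, max k.val l.val) ∈
      ([(0, 1), (1, 2), (2, 3), (3, 4), (4, 5), (0, 5), (6, 7), (7, 8), (8, 9), (9, 10), (10, 11), (6, 11), (0, 6), (1, 7), (2, 8), (3, 9), (4, 10), (5, 11), (1, 6), (2, 7), (3, 8), (4, 9), (5, 10), (0, 11)] : List (ℕ × ℕ)))) : False := by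
  have hp : ∀ k, 0 < ‖t k‖ := fun k => by linarith [(hn k).1]
  have bond : ∀ k l : Fin 12, k ≠ l → (min k.val l.val, max k.val l.val) ∈ apList →
      1 - 1 / 50 ≤ dist (t k) (t l) ∧ dist (t k) (t l) ≤ 1 + 1 / 50 :=
    fun k l h hm => ⟨(hd k l h).1, (hG k l h).2 hm⟩
  have far : ∀ k l : Fin 12, k ≠ l → (min k.val l.val, max k.val l.val) ∉ apList →
      63 / 50 ≤ dist (t k) (t l) :=
    fun k l h hm => ((hd k l h).2.resolve_left fun h' => hm ((hG k l h).1 h'))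
  -- the normalised points
  set u : Fin 12 → E3 := fun k => nrm(t k) with hu
  have hu1 : ∀ k, ‖u k‖ = 1 := fun k => norm_nrm (hp k)
  have uwin : ∀ k l : Fin 12, k ≠ l → (min k.val l.val, max k.val l.val) ∈ apList →
      2201 / 4802 ≤ ⟪u k, u l⟫ ∧ ⟪u k, u l⟫ ≤ 2801 / 5202 :=
    fun k l h hm => bond_inner (hn k) (hn l) (bond k l h hm)
  have ufar : ∀ k l : Fin 12, k ≠ l → (min k.val l.val, max k.val l.val) ∉ apList →
      ⟪u k, u l⟫ ≤ 1233 / 5202 :=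
    fun k l h hm => far_inner (hn k) (hn l) (far k l h hm)
  have corner : ∀ k l m : Fin 12, k ≠ l → k ≠ m → l ≠ m →
      (min k.val l.val, max k.val l.val) ∈ apList → (min k.val m.val, max k.val m.val) ∈ apList →
      (min l.val m.val, max l.val m.val) ∈ apList →
      Real.arccos (81 / 200) ≤ angle (perpTo (u k) (u l)) (perpTo (u k) (u m)) ∧
        angle (perpTo (u k) (u l)) (perpTo (u k) (u m)) ≤ Real.arccos (1 / 4) := by
    intro k l m hkl hkm hlm bkl bkm blm
    simp only [hu]
    rw [angle_perpTo_nrm (hp k) (hp l) (hp m)]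
    exact ⟨stub_tCornerMin (t k) (t l) (t m) (hn k) (hn l) (hn m) (bond k l hkl bkl)
      (bond k m hkm bkm) (bond l m hlm blm), stub_tCornerMax (t k) (t l) (t m) (hn k) (hn l) (hn m)
      (bond k l hkl bkl) (bond k m hkm bkm) (bond l m hlm blm)⟩
  -- the two rings
  set A : Fin 6 → E3 := fun i => u (Fin.castAdd 6 i) with hAdef
  set B : Fin 6 → E3 := fun i => u (Fin.natAdd 6 i) with hBdef
  have hA : ∀ i, ‖A i‖ = 1 := fun i => hu1 _
  have hB : ∀ i, ‖B i‖ = 1 := fun i => hu1 _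
  have hAA : ∀ i j, j = i + 1 → 2201 / 4802 ≤ ⟪A i, A j⟫ ∧ ⟪A i, A j⟫ ≤ 2801 / 5202 := by
    intro i j h; fin_cases i <;> subst h <;> exact uwin _ _ (by decide) (by decide)
  have hBB : ∀ i j, j = i + 1 → 2201 / 4802 ≤ ⟪B i, B j⟫ ∧ ⟪B i, B j⟫ ≤ 2801 / 5202 := by
    intro i j h; fin_cases i <;> subst h <;> exact uwin _ _ (by decide) (by decide)
  have hAB : ∀ i, 2201 / 4802 ≤ ⟪A i, B i⟫ ∧ ⟪A i, B i⟫ ≤ 2801 / 5202 := by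
    intro i; fin_cases i <;> exact uwin _ _ (by decide) (by decide)
  have hAB' : ∀ i j, j = i + 1 → 2201 / 4802 ≤ ⟪A j, B i⟫ ∧ ⟪A j, B i⟫ ≤ 2801 / 5202 := by
    intro i j h; fin_cases i <;> subst h <;> exact uwin _ _ (by decide) (by decide)
  have hfA : ∀ i j, j = i + 2 → ⟪A j, A i⟫ ≤ 1233 / 5202 := by
    intro i j h; fin_cases i <;> subst h <;> exact ufar _ _ (by decide) (by decide)
  have hfB : ∀ i j, j = i + 2 → ⟪B j, B i⟫ ≤ 1233 / 5202 := by
    intro i j h; fin_cases i <;> subst h <;> exact ufar _ _ (by decide) (by decide)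
  have hT1 : ∀ i j, j = i + 1 →
      Real.arccos (81 / 200) ≤ angle (perpTo (A i) (A j)) (perpTo (A i) (B i)) ∧
      angle (perpTo (A i) (A j)) (perpTo (A i) (B i)) ≤ Real.arccos (1 / 4) := by
    intro i j h; fin_cases i <;> subst h <;>
      exact corner _ _ _ (by decide) (by decide) (by decide) (by decide) (by decide) (by decide)
  have hT2 : ∀ i j, j = i + 1 →
      Real.arccos (81 / 200) ≤ angle (perpTo (A j) (B j)) (perpTo (A j) (B i)) ∧
      angle (perpTo (A j) (B j)) (perpTo (A j) (B i)) ≤ Real.arccos (1 / 4) := by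
    intro i j h; fin_cases i <;> subst h <;>
      exact corner _ _ _ (by decide) (by decide) (by decide) (by decide) (by decide) (by decide)
  have hT3 : ∀ i j, j = i + 1 →
      Real.arccos (81 / 200) ≤ angle (perpTo (A j) (B i)) (perpTo (A j) (A i)) ∧
      angle (perpTo (A j) (B i)) (perpTo (A j) (A i)) ≤ Real.arccos (1 / 4) := by
    intro i j h; fin_cases i <;> subst h <;>
      exact corner _ _ _ (by decide) (by decide) (by decide) (by decide) (by decide) (by decide)
  have hU1 : ∀ i j, j = i + 1 →
      Real.arccos (81 / 200) ≤ angle (perpTo (B j) (B i)) (perpTo (B j) (A j)) ∧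
      angle (perpTo (B j) (B i)) (perpTo (B j) (A j)) ≤ Real.arccos (1 / 4) := by
    intro i j h; fin_cases i <;> subst h <;>
      exact corner _ _ _ (by decide) (by decide) (by decide) (by decide) (by decide) (by decide)
  have hU2 : ∀ i j, j = i + 1 →
      Real.arccos (81 / 200) ≤ angle (perpTo (B i) (A i)) (perpTo (B i) (A j)) ∧
      angle (perpTo (B i) (A i)) (perpTo (B i) (A j)) ≤ Real.arccos (1 / 4) := by
    intro i j h; fin_cases i <;> subst h <;>
      exact corner _ _ _ (by decide) (by decide) (by decide) (by decide) (by decide) (by decide)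
  have hU3 : ∀ i j, j = i + 1 →
      Real.arccos (81 / 200) ≤ angle (perpTo (B i) (A j)) (perpTo (B i) (B j)) ∧
      angle (perpTo (B i) (A j)) (perpTo (B i) (B j)) ≤ Real.arccos (1 / 4) := by
    intro i j h; fin_cases i <;> subst h <;>
      exact corner _ _ _ (by decide) (by decide) (by decide) (by decide) (by decide) (by decide)
  -- the handedness of the configuration
  obtain ⟨hTm, hTM, -⟩ := T_bounds
  have hD0 : orient3 (A 0) (A 1) (B 0) ≠ 0 :=
    orient3_ne_zero_of_angle (hA 0)
      (perpTo_ne_zero_of_unit (hA 0) (hA 1) (sq_lt_one_of_window (hAA 0 1 rfl)))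
      (perpTo_ne_zero_of_unit (hA 0) (hB 0) (sq_lt_one_of_window (hAB 0)))
      (by linarith [(hT1 0 1 rfl).1, Real.pi_pos]) (by linarith [(hT1 0 1 rfl).2, Real.pi_pos])
  rcases lt_or_gt_of_ne hD0 with hneg | hpos
  · -- mirror image
    have hD0' : 0 < orient3 ((fun i => -A i) 0) ((fun i => -A i) 1) ((fun i => -B i) 0) := by
      simp only [orient3_neg_neg_neg]; linarith
    refine no_config (fun i => -A i) (fun i => -B i) (fun i => by rw [norm_neg]; exact hA i)
      (fun i => by rw [norm_neg]; exact hB i) ?_ ?_ ?_ ?_ ?_ ?_ ?_ ?_ ?_ ?_ ?_ ?_ hD0' <;>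
      simp only [inner_neg_neg, perpTo_neg_left, perpTo_neg_right, angle_neg_neg]
    exacts [hAA, hBB, hAB, hAB', hfA, hfB, hT1, hT2, hT3, hU1, hU2, hU3]
  · exact no_config A B hA hB hAA hBB hAB hAB' hfA hfB hT1 hT2 hT3 hU1 hU2 hU3 hpos

end Summit.AtomisticToContinuum.Crystallization.Theorems
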